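import Summits.Ventures.PercRepro.Night2NonFatLevelOne

/-!
# night-2: the NON-FAT case of (FAIR) — the capacity floor at every level (gen 37)

At a target `T = Q ∪ Y` of a basis pair (`Y ⊆ W = G ∖ Q` nonempty) the thin covering preimages are faces at the coloops of
`T ∖ K = Q′ ∪ Y` (g32, `L1_le_sum_base_req_coloops`), and a coloop `w ∈ Q′` of `Q′ ∪ Y` has `Y ⊆ cl (Q′ ∖ w)` — a point `y ∈ Y`
off `cl (Q′ ∖ w)` would make `(Q′ ∖ w) ∪ {y} ⊆ (Q′ ∪ Y) ∖ w` of rank `5 = rk V`, so `w` would lie in its closure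
(`subset_clF_erase_of_mem_coloops_union`).  Hence **`L1_union_le_sum_support`**: `L1 (Q ∪ Y) ≤ Σ_{w active, Y ⊆ cl (Q.erase w)} r_w`
(the requests of the active faces whose hyperplane contains all of `Y`), and **`vCap_union_ge`**: at an UNLOADED target
`vCap (Q ∪ Y) ≥ 11/18 − that sum`.  With `S(Y) = ∪_{y ∈ Y} S(y)` (`S(y) = {w : y ∉ H_w}`) this is the floor
`v(Y) = 11/18 − Σ_{w active ∖ S(Y)} r_w = Σ_{w ∈ S(Y) active} r_w − (L − 11/18)` of the numerics (paper g37 §7, FLOOR).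
Paper: proofs/NIGHT-2-g37.md §6.
-/

namespace PercRepro.Shadow

open PercRepro.ThmH PercRepro.PerFlat

variable {α : Type*} [DecidableEq α] {M : Matroid α} [M.Finite] {G : Finset α}

/-- `(Q ∪ Y) ∖ K = (Q ∖ K) ∪ Y` when `Y ∩ K = ∅`. -/
theorem union_sdiff_coloops_eq {Q Y : Finset α} (hY : Disjoint Y (coloops M G)) :
    (Q ∪ Y) \ coloops M G = (Q \ coloops M G) ∪ Y := by
  ext e
  simp only [Finset.mem_sdiff, Finset.mem_union]
  constructor
  · rintro ⟨h | h, hK⟩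
    · exact Or.inl ⟨h, hK⟩
    · exact Or.inr h
  · rintro (⟨h, hK⟩ | h)
    · exact ⟨Or.inl h, hK⟩
    · exact ⟨Or.inr h, Finset.disjoint_left.1 hY h⟩

/-- **A coloop `w ∈ Q′` of `Q′ ∪ Y` has `Y ⊆ cl (Q′ ∖ w)`.** -/
theorem subset_clF_erase_of_mem_coloops_union (hG : G ∈ flatsQ M (5 + 1)) (hd : (gr M \ G).card = 2)
    (hk : kColoops M G = 1) {B : Finset α} (hB : B ∈ thinMembers M 5 G) (hnP : ¬ bigP M G B) {z : α}
    (hz : z ∈ G \ clF M B) {Y : Finset α} (hY : Y ⊆ G \ insert z B) {w : α} (hw : w ∈ insert z B \ coloops M G)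
    (hcol : w ∈ coloops M ((insert z B ∪ Y) \ coloops M G)) : Y ⊆ clF M ((insert z B).erase w) := by
  intro y hyY
  have hy := hY hyY
  have hd' : (gr M \ G).card ≤ 5 := by omega
  have hGg : G ⊆ gr M := (mem_flatsQ.1 hG).1
  have hBG : B ⊆ G := subset_G_of_mem_thinMembers hB
  have hQG : insert z B ⊆ G := Finset.insert_subset (Finset.mem_sdiff.1 hz).1 hBG
  have hKB : coloops M G ⊆ B := coloops_subset_of_mem_thinMembers hG hd' hB
  have hyG : y ∈ G := (Finset.mem_sdiff.1 hy).1
  have hyQ : y ∉ insert z B := (Finset.mem_sdiff.1 hy).2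
  have hYK : Disjoint Y (coloops M G) := by
    rw [Finset.disjoint_left]
    intro e heY heK
    exact (Finset.mem_sdiff.1 (hY heY)).2 (Finset.mem_insert_of_mem (hKB heK))
  have hwQ : w ∈ insert z B := (Finset.mem_sdiff.1 hw).1
  have hwK : w ∉ coloops M G := (Finset.mem_sdiff.1 hw).2
  have hyw : y ≠ w := fun h => hyQ (h ▸ hwQ)
  by_contra hcl
  have hQ'rk : rkN M (insert z B \ coloops M G) = (insert z B \ coloops M G).card :=
    rkN_eq_card_of_subset_of_rkN_eq_card (rkN_insert_eq_card hG hd hk hB hnP hz) Finset.sdiff_subset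
  have hQ'card : (insert z B \ coloops M G).card = 5 := by
    have h4 := card_sdiff_eq_four_of_not_bigP hG hd hk hB hnP
    have hzB : z ∉ B := fun h => (Finset.mem_sdiff.1 hz).2 (subset_clF_of_subset_gr (hBG.trans hGg) h)
    rw [insert_sdiff_coloops_eq (fun h => hzB (hKB h)), Finset.card_insert_of_notMem
      (fun h => hzB (Finset.mem_sdiff.1 h).1), h4]
  have herase_sub : (insert z B \ coloops M G).erase w ⊆ (insert z B).erase w :=
    Finset.erase_subset_erase _ Finset.sdiff_subset
  have hcl' : y ∉ clF M ((insert z B \ coloops M G).erase w) := fun h => hcl (clF_mono herase_sub h)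
  have hr4 : rkN M ((insert z B \ coloops M G).erase w) = 4 := by
    rw [rkN_eq_card_of_subset_of_rkN_eq_card hQ'rk (Finset.erase_subset _ _), Finset.card_erase_of_mem hw, hQ'card]
  have hr5 : rkN M (insert y ((insert z B \ coloops M G).erase w)) = 5 := by
    rw [rkN_insert_of_notMem_clF (M := M) (hGg hyG) hcl', hr4]
  -- `insert y ((Q′).erase w) ⊆ (T ∖ K).erase w ⊆ V`, so `(T ∖ K).erase w` has rank `5` and `w` is in its closure
  have hsub1 : insert y ((insert z B \ coloops M G).erase w) ⊆ ((insert z B ∪ Y) \ coloops M G).erase w := by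
    rw [union_sdiff_coloops_eq hYK]
    apply Finset.insert_subset
    · exact Finset.mem_erase.2 ⟨hyw, Finset.mem_union_right _ hyY⟩
    · exact Finset.erase_subset_erase _ Finset.subset_union_left
  have hsub2 : insert w (((insert z B ∪ Y) \ coloops M G).erase w) ⊆ G \ coloops M G := by
    apply Finset.insert_subset (Finset.mem_sdiff.2 ⟨hQG hwQ, hwK⟩)
    refine (Finset.erase_subset _ _).trans (Finset.sdiff_subset_sdiff ?_ (le_refl _))
    exact Finset.union_subset hQG (hY.trans Finset.sdiff_subset)
  have hV5 := rkN_sdiff_coloops_eq_five hG hk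
  have h1 := rkN_mono (M := M) hsub1
  have h2 := rkN_mono (M := M) hsub2
  have hle : rkN M (insert w (((insert z B ∪ Y) \ coloops M G).erase w)) ≤
      rkN M (((insert z B ∪ Y) \ coloops M G).erase w) := by omega
  have hmem := mem_clF_of_rkN_insert_le (M := M) (hGg (hQG hwQ)) hle
  rw [mem_coloops] at hcol
  exact hcol.2 hmem

/-- **`L1` at any target is at most the sum of the requests of the active faces whose hyperplane contains `Y`.** -/
theorem L1_union_le_sum_support (hG : G ∈ flatsQ M (5 + 1)) (hd : (gr M \ G).card = 2)
    (hk : kColoops M G = 1) {B : Finset α} (hB : B ∈ thinMembers M 5 G) (hnP : ¬ bigP M G B) {z : α}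
    (hz : z ∈ G \ clF M B) {Y : Finset α} (hY : Y ⊆ G \ insert z B) (hne : Y.Nonempty) :
    L1 M 5 G (insert z B ∪ Y) ≤ ∑ w ∈ (insert z B \ coloops M G).filter
      (fun w => faceOk M G (insert z B) w ∧ Y ⊆ clF M ((insert z B).erase w)), req M 5 ((insert z B).erase w) := by
  have hT : insert z B ∪ Y ∈ tgtSets M 5 G B z := by
    rw [tgtSets_eq_image hG (mem_thinMembers.1 hB).1 hz, Finset.mem_image]
    exact ⟨Y, Finset.mem_filter.2 ⟨Finset.mem_powerset.2 hY, hne⟩, rfl⟩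
  refine le_trans (L1_le_sum_base_req_coloops hG hd hk hB hz hT) ?_
  apply Finset.sum_le_sum_of_subset_of_nonneg
  · intro w hw
    rw [Finset.mem_filter] at hw ⊢
    exact ⟨hw.1, hw.2.1, subset_clF_erase_of_mem_coloops_union hG hd hk hB hnP hz hY hw.1 hw.2.2⟩
  · intro w _ _
    exact req_nonneg _ _

/-- **The capacity floor at an unloaded target of any level**: `vCap (Q ∪ Y) ≥ 11/18 − Σ_{w active, Y ⊆ cl (Q.erase w)} r_w`. -/
theorem vCap_union_ge (hG : G ∈ flatsQ M (5 + 1)) (hd : (gr M \ G).card = 2) (hk : kColoops M G = 1)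
    {B : Finset α} (hB : B ∈ thinMembers M 5 G) (hnP : ¬ bigP M G B) {z : α} (hz : z ∈ G \ clF M B)
    {Y : Finset α} (hY : Y ⊆ G \ insert z B) (hne : Y.Nonempty)
    (hdl : dload M 5 G (bigP M G) (dshGT2 M 5 G) (insert z B ∪ Y) = 0) :
    11 / 18 - ∑ w ∈ (insert z B \ coloops M G).filter
      (fun w => faceOk M G (insert z B) w ∧ Y ⊆ clF M ((insert z B).erase w)), req M 5 ((insert z B).erase w) ≤
    vCap M G (insert z B ∪ Y) := by
  have hL1 := L1_union_le_sum_support hG hd hk hB hnP hz hY hne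
  have hsum0 : 0 ≤ ∑ w ∈ (insert z B \ coloops M G).filter
      (fun w => faceOk M G (insert z B) w ∧ Y ⊆ clF M ((insert z B).erase w)), req M 5 ((insert z B).erase w) :=
    Finset.sum_nonneg (fun w _ => req_nonneg _ _)
  have hTG : insert z B ∪ Y ⊆ G :=
    Finset.union_subset (Finset.insert_subset (Finset.mem_sdiff.1 hz).1 (subset_G_of_mem_thinMembers hB))
      (hY.trans Finset.sdiff_subset)
  have hcap := capS_ge_eleven_eighteenths_two_one hd hk hTG
  unfold vCap
  by_cases h1 : (G \ (insert z B ∪ Y)).card ≤ 1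
  · rw [if_pos h1]
    linarith
  · rw [if_neg h1, if_pos hdl]
    refine le_trans ?_ (le_max_right _ _)
    linarith

end PercRepro.Shadow
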